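import Literature.Analysis.ODE.ParametricSecondOrder
import HarnessLib

/-!
# Continuous and holomorphic dependence on a parameter for `y'' = Q(p) y` with parameter-dependent
# data; joint continuity in (parameter, time)

Topic `Literature/Analysis/ODE` (namespace `Literature.Analysis.ODE`), continuing
`ParametricSecondOrder.lean` (`𝕜 = ℝ` or `ℂ`), whose main theorems assume data at `t₀`
independent of the parameter. Writing an arbitrary solution as `y(p) = y(p, t₀) Y₀(p) + y'(p, t₀) Y₁(p)`
in the basis `Y₀, Y₁` with data `(1, 0)`, `(0, 1)` at `t₀` gives (theorems only, everything proved):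

* `IsSol2.congr_coeff` — changing the coefficient on the set of definition;
* `IsSol2.eqOn_basis` — the basis representation on `(r₀, ∞)`;
* `tendstoUniformlyOn_param_of_data` — `(y p, y' p) → (y p₀, y' p₀)` uniformly on `[a, b]` when
  the coefficients `g i` and the data `y p t₀`, `y' p t₀` are continuous at `p₀`;
* `differentiableAt_param_of_data` — differentiability (holomorphy for `𝕜 = ℂ`) of `p ↦ y p t`,
  `p ↦ y' p t` at `p₀` when the `g i` and the data are differentiable at `p₀`;
* `continuousAt_uncurry_of_tendstoUniformlyOn` — locally uniform convergence in the parameter plus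
  continuity in time give joint continuity.

## References
* P. Hartman, *Ordinary Differential Equations*, SIAM Classics 38 (2002), Ch. V Thm. 2.1, Thm. 3.1.
  Key `Hartman2002`.
-/

noncomputable section

open Set Metric Filter
open scoped Topology

namespace Literature.Analysis.ODE

variable {𝕜 : Type*} [RCLike 𝕜]

/-! ## Basis representation with parameter-dependent data -/

/-- Changing the coefficient on the set of definition. [folklore] -/
theorem IsSol2.congr_coeff {Q Q' : ℝ → 𝕜} {y y' : ℝ → 𝕜} {s : Set ℝ} (h : IsSol2 Q y y' s)
    (hQ : EqOn Q Q' s) : IsSol2 Q' y y' s :=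
  ⟨h.hasDerivAt, fun t ht ↦ by rw [← hQ ht]; exact h.hasDerivAt_deriv t ht⟩

/-- **Basis representation.** If `Y₀`, `Y₁` solve the equation on `(r₀, ∞)` with data `(1, 0)`,
`(0, 1)` at `t₀ > r₀`, then every solution is `y = y(t₀) Y₀ + y'(t₀) Y₁` there (with derivatives).
[cite: Hartman2002, Ch. IV §8] -/
theorem IsSol2.eqOn_basis {Q : ℝ → 𝕜} {r₀ t₀ : ℝ} (hQ : ContinuousOn Q (Ioi r₀)) (ht₀ : r₀ < t₀)
    {Y₀ Y₀' Y₁ Y₁' y y' : ℝ → 𝕜} (h₀ : IsSol2 Q Y₀ Y₀' (Ioi r₀)) (h₁ : IsSol2 Q Y₁ Y₁' (Ioi r₀))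
    (h00 : Y₀ t₀ = 1) (h01 : Y₀' t₀ = 0) (h10 : Y₁ t₀ = 0) (h11 : Y₁' t₀ = 1) (hy : IsSol2 Q y y' (Ioi r₀)) :
    EqOn y (fun t ↦ y t₀ * Y₀ t + y' t₀ * Y₁ t) (Ioi r₀) ∧
      EqOn y' (fun t ↦ y t₀ * Y₀' t + y' t₀ * Y₁' t) (Ioi r₀) :=
  hy.eqOn_Ioi hQ (h₀.combination h₁ _ _) ht₀ (by simp [h00, h10]) (by simp [h01, h11])

section Parametric

variable {ι : Type*} [Fintype ι]

/-- **Continuous dependence with parameter-dependent data.** For coefficients in separated form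
`Q p t = Σ_i g i p · h i t` with `g i` continuous at `p₀` and `h i` continuous on `(r₀, ∞)`, and
solutions `y p` of `y'' = Q p · y` on `(r₀, ∞)` whose data at `t₀ ∈ [a, b] ⊂ (r₀, ∞)` are continuous
in `p` at `p₀`: `(y p, y' p) → (y p₀, y' p₀)` uniformly on `[a, b]`. [cite: Hartman2002, Ch. V Thm. 2.1] -/
theorem tendstoUniformlyOn_param_of_data {P : Type*} [TopologicalSpace P] {g : ι → P → 𝕜}
    {h : ι → ℝ → 𝕜} {r₀ a b t₀ : ℝ} (hab : Icc a b ⊆ Ioi r₀) (ht₀ : t₀ ∈ Icc a b) {p₀ : P}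
    (hg : ∀ i, ContinuousAt (g i) p₀) (hh : ∀ i, ContinuousOn (h i) (Ioi r₀))
    {y y' : P → ℝ → 𝕜} (hy : ∀ p, IsSol2 (fun t ↦ ∑ i, g i p * h i t) (y p) (y' p) (Ioi r₀))
    (h0 : ContinuousAt (fun p ↦ y p t₀) p₀) (h1 : ContinuousAt (fun p ↦ y' p t₀) p₀) :
    TendstoUniformlyOn (fun p t ↦ (y p t, y' p t)) (fun t ↦ (y p₀ t, y' p₀ t)) (𝓝 p₀) (Icc a b) := by
  have ht₀r : r₀ < t₀ := hab ht₀
  -- the coefficient of parameter `p` is continuous on `(r₀, ∞)`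
  have hQc : ∀ p, ContinuousOn (fun t ↦ ∑ i, g i p * h i t) (Ioi r₀) := fun p ↦
    continuousOn_finsetSum _ fun i _ ↦ continuousOn_const.mul (hh i)
  -- basis solutions with fixed data
  choose Y₀ Y₀' hY₀ hY₀0 hY₀1 using fun p ↦ exists_isSol2_Ioi (hQc p) t₀ (1 : 𝕜) 0
  choose Y₁ Y₁' hY₁ hY₁0 hY₁1 using fun p ↦ exists_isSol2_Ioi (hQc p) t₀ (0 : 𝕜) 1
  have hU₀ := tendstoUniformlyOn_param hab ht₀ hg (fun i ↦ (hh i).mono hab) hY₀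
    (fun p ↦ by rw [hY₀0, hY₀0]) (fun p ↦ by rw [hY₀1, hY₀1]) (p₀ := p₀)
  have hU₁ := tendstoUniformlyOn_param hab ht₀ hg (fun i ↦ (hh i).mono hab) hY₁
    (fun p ↦ by rw [hY₁0, hY₁0]) (fun p ↦ by rw [hY₁1, hY₁1]) (p₀ := p₀)
  -- representation
  have hrep : ∀ p, ∀ t ∈ Ioi r₀, y p t = y p t₀ * Y₀ p t + y' p t₀ * Y₁ p t ∧
      y' p t = y p t₀ * Y₀' p t + y' p t₀ * Y₁' p t := by
    intro p t ht
    have h := IsSol2.eqOn_basis (hQc p) ht₀r (hY₀ p) (hY₁ p) (hY₀0 p) (hY₀1 p) (hY₁0 p) (hY₁1 p) (hy p)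
    exact ⟨h.1 ht, h.2 ht⟩
  -- bounds for the basis at `p₀` on `[a, b]`
  obtain ⟨B₀, hB₀0, hB₀⟩ := (hY₀ p₀).exists_norm_le_Icc hab
  obtain ⟨B₁, hB₁0, hB₁⟩ := (hY₁ p₀).exists_norm_le_Icc hab
  obtain ⟨C₀, hC₀⟩ := (isCompact_Icc.image_of_continuousOn ((hY₀ p₀).continuousOn.2.mono hab)).isBounded.exists_norm_le
  obtain ⟨C₁, hC₁⟩ := (isCompact_Icc.image_of_continuousOn ((hY₁ p₀).continuousOn.2.mono hab)).isBounded.exists_norm_le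
  set B : ℝ := 1 + B₀ + B₁ + |C₀| + |C₁| with hB
  have hBY : ∀ t ∈ Icc a b, ‖Y₀ p₀ t‖ ≤ B - 1 ∧ ‖Y₁ p₀ t‖ ≤ B - 1 ∧ ‖Y₀' p₀ t‖ ≤ B - 1 ∧ ‖Y₁' p₀ t‖ ≤ B - 1 := by
    intro t ht
    have h1 := hB₀ t ht; have h2 := hB₁ t ht
    have h3 : ‖Y₀' p₀ t‖ ≤ |C₀| := (hC₀ _ (mem_image_of_mem _ ht)).trans (le_abs_self _)
    have h4 : ‖Y₁' p₀ t‖ ≤ |C₁| := (hC₁ _ (mem_image_of_mem _ ht)).trans (le_abs_self _)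
    refine ⟨?_, ?_, ?_, ?_⟩ <;> [skip; skip; skip; skip] <;>
      linarith [abs_nonneg C₀, abs_nonneg C₁, norm_nonneg (Y₀ p₀ t), norm_nonneg (Y₁ p₀ t)]
  have hB1 : 1 ≤ B := by
    have := abs_nonneg C₀; have := abs_nonneg C₁; linarith
  set D : ℝ := 1 + ‖y p₀ t₀‖ + ‖y' p₀ t₀‖ with hD
  have hD1 : 1 ≤ D := by have := norm_nonneg (y p₀ t₀); have := norm_nonneg (y' p₀ t₀); linarith
  rw [Metric.tendstoUniformlyOn_iff]
  intro ε hε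
  set δ : ℝ := min 1 (ε / (8 * B * D)) with hδ
  have hδ0 : 0 < δ := lt_min one_pos (by positivity)
  have hδ1 : δ ≤ 1 := min_le_left _ _
  have hδ2 : δ ≤ ε / (8 * B * D) := min_le_right _ _
  -- eventual smallness of the four differences
  have e0 := Metric.tendsto_nhds.1 h0 δ hδ0
  have e1 := Metric.tendsto_nhds.1 h1 δ hδ0
  have eU₀ := (Metric.tendstoUniformlyOn_iff.1 hU₀) δ hδ0
  have eU₁ := (Metric.tendstoUniformlyOn_iff.1 hU₁) δ hδ0
  filter_upwards [e0, e1, eU₀, eU₁] with p hp0 hp1 hpU₀ hpU₁ t ht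
  have htr : t ∈ Ioi r₀ := hab ht
  obtain ⟨hy0, hy1⟩ := hrep p t htr
  obtain ⟨hz0, hz1⟩ := hrep p₀ t htr
  obtain ⟨bY₀, bY₁, bY₀', bY₁'⟩ := hBY t ht
  have hu₀ := hpU₀ t ht
  have hu₁ := hpU₁ t ht
  rw [Prod.dist_eq, max_lt_iff] at hu₀ hu₁
  obtain ⟨hu₀1, hu₀2⟩ := hu₀
  obtain ⟨hu₁1, hu₁2⟩ := hu₁
  simp only [dist_eq_norm] at hu₀1 hu₀2 hu₁1 hu₁2
  rw [dist_eq_norm] at hp0 hp1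
  rw [Prod.dist_eq, max_lt_iff]
  simp only [dist_eq_norm]
  -- norms of the perturbed basis
  have nY₀ : ‖Y₀ p t‖ ≤ B := by
    have := norm_sub_norm_le (Y₀ p t) (Y₀ p₀ t); rw [norm_sub_rev] at this; linarith
  have nY₁ : ‖Y₁ p t‖ ≤ B := by
    have := norm_sub_norm_le (Y₁ p t) (Y₁ p₀ t); rw [norm_sub_rev] at this; linarith
  have nY₀' : ‖Y₀' p t‖ ≤ B := by
    have := norm_sub_norm_le (Y₀' p t) (Y₀' p₀ t); rw [norm_sub_rev] at this; linarith
  have nY₁' : ‖Y₁' p t‖ ≤ B := by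
    have := norm_sub_norm_le (Y₁' p t) (Y₁' p₀ t); rw [norm_sub_rev] at this; linarith
  have nc₀ : ‖y p₀ t₀‖ ≤ D := by have := norm_nonneg (y' p₀ t₀); linarith
  have nc₁ : ‖y' p₀ t₀‖ ≤ D := by have := norm_nonneg (y p₀ t₀); linarith
  -- the key estimate, for a generic bilinear combination
  have key : ∀ (c₀ c₁ d₀ d₁ U₀ U₁ V₀ V₁ : 𝕜), ‖c₀ - d₀‖ < δ → ‖c₁ - d₁‖ < δ → ‖V₀ - U₀‖ < δ → ‖V₁ - U₁‖ < δ →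
      ‖U₀‖ ≤ B → ‖U₁‖ ≤ B → ‖d₀‖ ≤ D → ‖d₁‖ ≤ D →
      ‖(d₀ * V₀ + d₁ * V₁) - (c₀ * U₀ + c₁ * U₁)‖ < ε := by
    intro c₀ c₁ d₀ d₁ U₀ U₁ V₀ V₁ h1 h2 h3 h4 h5 h6 h7 h8
    have hsplit : (d₀ * V₀ + d₁ * V₁) - (c₀ * U₀ + c₁ * U₁) =
        d₀ * (V₀ - U₀) + (d₀ - c₀) * U₀ + (d₁ * (V₁ - U₁) + (d₁ - c₁) * U₁) := by ring
    rw [hsplit]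
    have hn : ‖d₀ * (V₀ - U₀) + (d₀ - c₀) * U₀ + (d₁ * (V₁ - U₁) + (d₁ - c₁) * U₁)‖ ≤
        D * δ + δ * B + (D * δ + δ * B) := by
      refine (norm_add_le _ _).trans (add_le_add ((norm_add_le _ _).trans (add_le_add ?_ ?_))
        ((norm_add_le _ _).trans (add_le_add ?_ ?_)))
      · rw [norm_mul]; exact mul_le_mul h7 h3.le (norm_nonneg _) (by linarith)
      · rw [norm_mul, norm_sub_rev]; exact mul_le_mul h1.le h5 (norm_nonneg _) hδ0.le
      · rw [norm_mul]; exact mul_le_mul h8 h4.le (norm_nonneg _) (by linarith)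
      · rw [norm_mul, norm_sub_rev]; exact mul_le_mul h2.le h6 (norm_nonneg _) hδ0.le
    refine hn.trans_lt ?_
    have hε8 : D * δ + δ * B + (D * δ + δ * B) = 2 * δ * (D + B) := by ring
    rw [hε8]
    have hBD : D + B ≤ 2 * B * D := by nlinarith
    have hBDp : 0 < 8 * B * D := by positivity
    calc 2 * δ * (D + B) ≤ 2 * (ε / (8 * B * D)) * (2 * B * D) := by gcongr
      _ = ε / 2 := by field_simp; ring
      _ < ε := by linarith
  constructor
  · rw [hz0, hy0]
    exact key _ _ _ _ _ _ _ _ hp0 hp1 hu₀1 hu₁1 nY₀ nY₁ nc₀ nc₁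
  · rw [hz1, hy1]
    exact key _ _ _ _ _ _ _ _ hp0 hp1 hu₀2 hu₁2 nY₀' nY₁' nc₀ nc₁

/-- **Differentiable (holomorphic) dependence with parameter-dependent data.** For a scalar
parameter `p ∈ 𝕜`, coefficients `g i` differentiable at `p₀`, `h i` continuous on `(r₀, ∞)`, and
solutions `y p` on `(r₀, ∞)` whose data at `t₀ ∈ [a, b] ⊂ (r₀, ∞)` are differentiable in `p` at
`p₀`: `p ↦ y p t` and `p ↦ y' p t` are differentiable at `p₀` for every `t ∈ [a, b]`.
[cite: Hartman2002, Ch. V Thm. 3.1] -/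
theorem differentiableAt_param_of_data {g : ι → 𝕜 → 𝕜} {g' : ι → 𝕜} {h : ι → ℝ → 𝕜}
    {r₀ a b t₀ : ℝ} (hab : Icc a b ⊆ Ioi r₀) (ht₀ : t₀ ∈ Icc a b) {p₀ : 𝕜}
    (hg : ∀ i, HasDerivAt (g i) (g' i) p₀) (hh : ∀ i, ContinuousOn (h i) (Ioi r₀))
    {y y' : 𝕜 → ℝ → 𝕜} (hy : ∀ p, IsSol2 (fun t ↦ ∑ i, g i p * h i t) (y p) (y' p) (Ioi r₀))
    (h0 : DifferentiableAt 𝕜 (fun p ↦ y p t₀) p₀) (h1 : DifferentiableAt 𝕜 (fun p ↦ y' p t₀) p₀)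
    {t : ℝ} (ht : t ∈ Icc a b) :
    DifferentiableAt 𝕜 (fun p ↦ y p t) p₀ ∧ DifferentiableAt 𝕜 (fun p ↦ y' p t) p₀ := by
  have ht₀r : r₀ < t₀ := hab ht₀
  have hQc : ∀ p, ContinuousOn (fun t ↦ ∑ i, g i p * h i t) (Ioi r₀) := fun p ↦
    continuousOn_finsetSum _ fun i _ ↦ continuousOn_const.mul (hh i)
  choose Y₀ Y₀' hY₀ hY₀0 hY₀1 using fun p ↦ exists_isSol2_Ioi (hQc p) t₀ (1 : 𝕜) 0
  choose Y₁ Y₁' hY₁ hY₁0 hY₁1 using fun p ↦ exists_isSol2_Ioi (hQc p) t₀ (0 : 𝕜) 1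
  have hD₀ := differentiableAt_param hab ht₀ hg (fun i ↦ (hh i).mono hab) hY₀
    (fun p ↦ by rw [hY₀0, hY₀0]) (fun p ↦ by rw [hY₀1, hY₀1]) (p₀ := p₀) ht
  have hD₁ := differentiableAt_param hab ht₀ hg (fun i ↦ (hh i).mono hab) hY₁
    (fun p ↦ by rw [hY₁0, hY₁0]) (fun p ↦ by rw [hY₁1, hY₁1]) (p₀ := p₀) ht
  have htr : t ∈ Ioi r₀ := hab ht
  have hrep : ∀ p, y p t = y p t₀ * Y₀ p t + y' p t₀ * Y₁ p t ∧
      y' p t = y p t₀ * Y₀' p t + y' p t₀ * Y₁' p t := by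
    intro p
    have h := IsSol2.eqOn_basis (hQc p) ht₀r (hY₀ p) (hY₁ p) (hY₀0 p) (hY₀1 p) (hY₁0 p) (hY₁1 p) (hy p)
    exact ⟨h.1 htr, h.2 htr⟩
  constructor
  · have : (fun p ↦ y p t) = fun p ↦ y p t₀ * Y₀ p t + y' p t₀ * Y₁ p t := funext fun p ↦ (hrep p).1
    rw [this]
    exact (h0.mul hD₀.1).add (h1.mul hD₁.1)
  · have : (fun p ↦ y' p t) = fun p ↦ y p t₀ * Y₀' p t + y' p t₀ * Y₁' p t := funext fun p ↦ (hrep p).2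
    rw [this]
    exact (h0.mul hD₀.2).add (h1.mul hD₁.2)

end Parametric

/-! ## Joint continuity from locally uniform convergence -/

/-- **Joint continuity.** If `F x → F x₀` uniformly on a neighbourhood `s` of `t₀` as `x → x₀`, and
`F x₀` is continuous at `t₀`, then `(x, t) ↦ F x t` is continuous at `(x₀, t₀)`. [folklore] -/
theorem continuousAt_uncurry_of_tendstoUniformlyOn {X E : Type*} [TopologicalSpace X] [PseudoMetricSpace E]
    {F : X → ℝ → E} {x₀ : X} {t₀ : ℝ} {s : Set ℝ} (hs : s ∈ 𝓝 t₀)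
    (hU : TendstoUniformlyOn F (F x₀) (𝓝 x₀) s) (hc : ContinuousAt (F x₀) t₀) :
    ContinuousAt (Function.uncurry F) (x₀, t₀) := by
  rw [Metric.continuousAt_iff']
  intro ε hε
  have h1 := (Metric.tendstoUniformlyOn_iff.1 hU) (ε / 2) (half_pos hε)
  have h2 := Metric.tendsto_nhds.1 hc (ε / 2) (half_pos hε)
  have h3 : ∀ᶠ q : X × ℝ in 𝓝 (x₀, t₀), (∀ t ∈ s, dist (F x₀ t) (F q.1 t) < ε / 2) ∧
      dist (F x₀ q.2) (F x₀ t₀) < ε / 2 ∧ q.2 ∈ s := by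
    rw [nhds_prod_eq]
    exact (h1.prod_inl (𝓝 t₀)).and ((h2.and (eventually_mem_set.2 hs)).prod_inr (𝓝 x₀))
  filter_upwards [h3] with q hq
  obtain ⟨hq1, hq2, hq3⟩ := hq
  simp only [Function.uncurry_apply_pair]
  calc dist (F q.1 q.2) (F x₀ t₀) ≤ dist (F q.1 q.2) (F x₀ q.2) + dist (F x₀ q.2) (F x₀ t₀) := dist_triangle _ _ _
    _ < ε / 2 + ε / 2 := by rw [dist_comm]; exact add_lt_add (hq1 q.2 hq3) hq2
    _ = ε := by ring

end Literature.Analysis.ODE
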